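import Mathlib
import Literature.AlgebraicGeometry.Resolution.CohenMacaulayAvoidance
import Literature.AlgebraicGeometry.Resolution.CohenMacaulayCatenary
import Summits.Langlands.Langlands.Theorems.SkinnerWilesDefectOneReducibleOrdinaryProModularCohenMacaulayConnectedness

/-!
# Stub (R) `stub_raynaudConnectedness` for presentations by a regular sequence
# (quotients of Cohen–Macaulay local rings by regular sequences are Cohen–Macaulay)

Route `SkinnerWilesDefectOne`, crux `ReducibleOrdinaryProModular` (stmt-Langlands-12919), line
`fine-selmer-codimension-two`, registered stub (R) `stub_raynaudConnectedness`: for `A` complete local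
Cohen–Macaulay ("an `A`-regular sequence in `𝔪` of length `dim A`") and `R ≅ A ⧸ I` with
`n + 1 + μ(I) ≤ dim A`, `Spec R` is connected in dimension `n` (crossing form).  Sequel of
`…HartshorneConnectedness.lean` and `…CohenMacaulayConnectedness.lean`.  This file settles the stub
in the COMPLETE-INTERSECTION CASE — `I` generated by an `A`-regular sequence `f₁, …, f_m ∈ 𝔪` — with no
local cohomology: then `A ⧸ I` is again Cohen–Macaulay of dimension `dim A − m` (Matsumura 17.4, Stacks
00N6/02JN) and Hartshorne's "Cohen–Macaulay local rings are connected in codimension one"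
(`connectedInCodimOne_of_isCohenMacaulay`) gives connectedness in dimension `dim A − m − 1 ≥ n`
(`μ(I) ≥ m` by Krull's height theorem in the form `dim A ≤ dim A/I + μ(I)`).  Sorry-free:

* `Theorems.avoidsMinimalPrimes_of_isRegular` — a regular sequence in a Noetherian ring avoids the
  minimal primes of its initial segments (minimal primes of `(f₁,…,f_l)` are associated to
  `A/(f₁,…,f_l)`, Mathlib `minimalPrimes_annihilator_subset_associatedPrimes`);
* `Theorems.exists_isRegular_append` — in a Cohen–Macaulay local ring every regular sequence in `𝔪`
  EXTENDS to one of length `dim A` (prime avoidance + the tree's Cohen–Macaulay avoidance theorem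
  `isRegular_of_forall_notMem_minimalPrimes`, Matsumura 17.4 (iii));
* `Theorems.exists_isRegular_quotient_ofList` — hence `A ⧸ (f₁,…,f_m)` carries a regular sequence in
  its maximal ideal of length `dim A − m = dim A ⧸ (f₁,…,f_m)` (Mathlib
  `ringKrullDim_add_length_eq_ringKrullDim_of_isRegular`): **quotients of Cohen–Macaulay local rings by
  regular sequences are Cohen–Macaulay** [Matsumura 17.4; Bruns–Herzog 2.1.3];
* `Theorems.connected_quotient_ofList_of_isRegular` — `A ⧸ (f₁,…,f_m)` is connected in dimension `n`
  for `n + 1 + m ≤ dim A`;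
* `FineSelmerCodimensionTwo.stub_raynaudConnectedness_auxRegularSequence` — the REGISTERED stub's
  statement, binders verbatim, under the extra hypothesis that `I` is generated by an `A`-regular
  sequence in `𝔪` (registered sub-goal).

What remains of (R): presentations `R_𝒟 ≅ A ⧸ I` whose `I` is NOT generated by a regular sequence
(`R_𝒟` not a complete intersection of the expected dimension) — Grothendieck's connectedness theorem
SGA2 XIII 2.1 proper.

References: H. Matsumura, *Commutative Ring Theory*, Thm. 17.4 [Matsumura1987]; W. Bruns, J. Herzog,
*Cohen–Macaulay rings*, Thm. 2.1.3 [BrunsHerzog1998]; R. Hartshorne, Amer. J. Math. 84 (1962), Cor. 2.4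
[Hartshorne1962]; The Stacks Project, Tags 00N6, 02JN [StacksProject]; C. Skinner, A. Wiles, Publ.
Math. IHÉS 89 (1999), App. A [SkinnerWiles1999].
-/

set_option linter.dupNamespace false -- project-wide option (lakefile weak.linter.dupNamespace); `Summit.Langlands.Langlands` is the mandated namespace
set_option autoImplicit false

namespace Summit.Langlands.Langlands.Theorems

open IsLocalRing RingTheory.Sequence
open scoped Pointwise

universe u

variable {A : Type u} [CommRing A]

/-! ## 1. Regular sequences avoid the minimal primes of their initial segments -/

/-- **A regular sequence avoids the minimal primes of its initial segments** (Noetherian ring): if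
`f₁, …, f_k` is `A`-regular then each `f_{l+1}` lies in no minimal prime of `(f₁, …, f_l)` — those are
associated primes of `A/(f₁,…,f_l)`, on which `f_{l+1}` is a non-zero-divisor.
[cite: Matsumura1987, Thm. 17.4] -/
theorem avoidsMinimalPrimes_of_isRegular [IsNoetherianRing A] {fs : List A} (h : IsRegular A fs) :
    Literature.AlgebraicGeometry.Resolution.AvoidsMinimalPrimes fs := by
  intro L₁ q L₂ hdec p hp hq
  rw [hdec] at h
  have h1 := (isWeaklyRegular_append_iff A L₁ (q :: L₂)).mp h.toIsWeaklyRegular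
  have h2 : IsSMulRegular (A ⧸ (Ideal.ofList L₁ • ⊤ : Submodule A A)) q :=
    ((isWeaklyRegular_cons_iff _ q L₂).mp h1.2).1
  set I : Ideal A := Ideal.ofList L₁ with hI
  have hI' : (I • ⊤ : Submodule A A) = I := by rw [smul_eq_mul, Ideal.mul_top]
  let e : (A ⧸ (I • ⊤ : Submodule A A)) ≃ₗ[A] (A ⧸ I) := Submodule.quotEquivOfEq _ _ hI'
  have h3 : IsSMulRegular (A ⧸ I) q := (e.isSMulRegular_congr q).mp h2
  have hp' : p ∈ associatedPrimes A (A ⧸ I) := by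
    apply Module.associatedPrimes.minimalPrimes_annihilator_subset_associatedPrimes A (A ⧸ I)
    rwa [Ideal.annihilator_quotient]
  exact Literature.AlgebraicGeometry.Resolution.not_mem_of_isSMulRegular hp' h3 hq

/-- Appending one element which avoids the minimal primes of `(f₁,…,f_k)` to a sequence avoiding the
minimal primes of its initial segments gives such a sequence again. [folklore] -/
theorem avoidsMinimalPrimes_append_singleton {fs : List A} {g : A}
    (hfs : Literature.AlgebraicGeometry.Resolution.AvoidsMinimalPrimes fs)
    (hg : ∀ p ∈ (Ideal.ofList fs).minimalPrimes, g ∉ p) :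
    Literature.AlgebraicGeometry.Resolution.AvoidsMinimalPrimes (fs ++ [g]) := by
  intro L₁ q L₂ hdec p hp
  rcases List.append_eq_append_iff.mp hdec with ⟨a', hL₁, hga⟩ | ⟨c', hfs', hqc⟩
  · -- `L₁ = fs ++ a'`, `[g] = a' ++ q :: L₂`: forces `a' = []`, `q = g`
    cases a' with
    | nil =>
      simp only [List.nil_append, List.cons.injEq] at hga
      obtain ⟨rfl, -⟩ := hga
      rw [List.append_nil] at hL₁
      subst hL₁
      exact hg p hp
    | cons b a'' =>
      exfalso
      have := congrArg List.length hga
      simp at this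
  · -- `fs = L₁ ++ c'`, `q :: L₂ = c' ++ [g]`
    cases c' with
    | nil =>
      simp only [List.nil_append, List.cons.injEq] at hqc
      obtain ⟨rfl, -⟩ := hqc
      rw [List.append_nil] at hfs'
      subst hfs'
      exact hg p hp
    | cons q' c'' =>
      simp only [List.cons_append, List.cons.injEq] at hqc
      obtain ⟨rfl, -⟩ := hqc
      exact hfs L₁ q c'' hfs' p hp

/-! ## 2. Dimension bookkeeping in `WithBot ℕ∞` -/

/-- If `x + m = d` in `WithBot ℕ∞` with `m, d` natural numbers, then `x = d − m` and `m ≤ d`.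
[folklore] -/
theorem WithBot.eq_natCast_sub_of_add_natCast_eq {x : WithBot ℕ∞} {m d : ℕ}
    (h : x + (m : WithBot ℕ∞) = (d : WithBot ℕ∞)) : x = ((d - m : ℕ) : WithBot ℕ∞) ∧ m ≤ d := by
  induction x using WithBot.recBotCoe with
  | bot => exact absurd h (by simp)
  | coe a =>
    induction a using ENat.recTopCoe with
    | top =>
      exfalso
      have h' : ((⊤ : ℕ∞) : WithBot ℕ∞) + (m : WithBot ℕ∞) = ((⊤ : ℕ∞) : WithBot ℕ∞) := by
        rw [← WithBot.coe_natCast, ← WithBot.coe_add, top_add]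
      rw [h'] at h
      exact ENat.top_ne_coe d (WithBot.coe_eq_coe.mp (by exact_mod_cast h))
    | coe k =>
      have hk : k + m = d := by exact_mod_cast h
      exact ⟨by congr 1; exact_mod_cast (show k = d - m by omega), by omega⟩

/-! ## 3. Extending regular sequences in a Cohen–Macaulay local ring -/

section CM

variable [IsNoetherianRing A] [IsLocalRing A] {rs : List A}

omit [IsNoetherianRing A] in
/-- In a local ring, if `𝔪` is a minimal prime of `I` then `A ⧸ I` is zero-dimensional: `V(I) = {𝔪}`.
[folklore] -/
theorem ringKrullDim_quotient_lt_one_of_maximalIdeal_mem_minimalPrimes {I : Ideal A}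
    (h : maximalIdeal A ∈ I.minimalPrimes) : ¬ (1 : WithBot ℕ∞) ≤ ringKrullDim (A ⧸ I) := by
  rw [ringKrullDim_quotient, Order.one_le_krullDim_iff]
  rintro ⟨x, y, hxy⟩
  have hyx : (y : PrimeSpectrum A) ≤ x := by
    have hy : (y : PrimeSpectrum A).asIdeal ≤ maximalIdeal A :=
      IsLocalRing.le_maximalIdeal (y : PrimeSpectrum A).isPrime.ne_top
    have hx : maximalIdeal A ≤ (x : PrimeSpectrum A).asIdeal :=
      h.2 ⟨(x : PrimeSpectrum A).isPrime, fun r hr => x.2 hr⟩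
        (IsLocalRing.le_maximalIdeal (x : PrimeSpectrum A).isPrime.ne_top)
    exact (PrimeSpectrum.asIdeal_le_asIdeal _ _).mp (hy.trans hx)
  exact hxy.2 ((PrimeSpectrum.asIdeal_le_asIdeal _ _).mpr hyx)

/-- **One more element**: in a Cohen–Macaulay local ring, a regular sequence `f₁, …, f_m ∈ 𝔪` with
`m < dim A` extends by some `g ∈ 𝔪` to a regular sequence `f₁, …, f_m, g` (choose `g ∈ 𝔪` outside the
minimal primes of `(f)` — possible since `dim A/(f) = dim A − m ≥ 1` — and apply Cohen–Macaulay
avoidance). [cite: Matsumura1987, Thm. 17.4] -/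
theorem exists_isRegular_append_singleton (hreg : IsRegular A rs) (hmem : ∀ r ∈ rs, r ∈ maximalIdeal A)
    (hdim : (rs.length : WithBot ℕ∞) = ringKrullDim A) {fs : List A} (hf : IsRegular A fs)
    (hfm : ∀ f ∈ fs, f ∈ maximalIdeal A) (hlt : fs.length < rs.length) :
    ∃ g ∈ maximalIdeal A, IsRegular A (fs ++ [g]) := by
  classical
  set I : Ideal A := Ideal.ofList fs with hI
  -- `dim A/I = dim A − m ≥ 1`
  have hdimI : (1 : WithBot ℕ∞) ≤ ringKrullDim (A ⧸ I) := by
    have h := ringKrullDim_add_length_eq_ringKrullDim_of_isRegular fs hf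
    rw [← hdim] at h
    obtain ⟨h1, -⟩ := WithBot.eq_natCast_sub_of_add_natCast_eq h
    rw [h1]
    exact_mod_cast (show 1 ≤ rs.length - fs.length by omega)
  -- so `𝔪` is not a minimal prime of `I`, and `𝔪 ⊄ ⋃ Min(I)`
  have hm : maximalIdeal A ∉ I.minimalPrimes := fun h =>
    ringKrullDim_quotient_lt_one_of_maximalIdeal_mem_minimalPrimes h hdimI
  have hfin : I.minimalPrimes.Finite := Ideal.finite_minimalPrimes_of_isNoetherianRing A I
  have havoid : ¬ ((maximalIdeal A : Set A) ⊆ ⋃ p ∈ (hfin.toFinset : Set (Ideal A)), ((p : Ideal A) : Set A)) := by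
    intro hsub
    obtain ⟨p, hp, hmp⟩ := (Ideal.subset_union_prime (s := hfin.toFinset)
      (f := fun p : Ideal A => p) (⊥ : Ideal A) (⊥ : Ideal A)
      (fun p hp _ _ => (hfin.mem_toFinset.mp hp).1.1)).mp hsub
    have hp' := hfin.mem_toFinset.mp hp
    have hpm : p = maximalIdeal A := le_antisymm (IsLocalRing.le_maximalIdeal hp'.1.1.ne_top) hmp
    exact hm (hpm ▸ hp')
  obtain ⟨g, hgm, hg⟩ := Set.not_subset.mp havoid
  have hg' : ∀ p ∈ I.minimalPrimes, g ∉ p := fun p hp hgp =>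
    hg (Set.mem_iUnion₂.mpr ⟨p, hfin.mem_toFinset.mpr hp, hgp⟩)
  refine ⟨g, hgm, ?_⟩
  refine Literature.AlgebraicGeometry.Resolution.isRegular_of_forall_notMem_minimalPrimes hreg hmem hdim
    (fun q hq => ?_) (avoidsMinimalPrimes_append_singleton (avoidsMinimalPrimes_of_isRegular hf) hg')
  rcases List.mem_append.mp hq with hq | hq
  · exact hfm q hq
  · rw [List.mem_singleton] at hq
    exact hq ▸ hgm

/-- **Regular sequences extend to maximal ones**: in a Cohen–Macaulay local ring every `A`-regular
sequence `f₁, …, f_m ∈ 𝔪` extends to an `A`-regular sequence `f₁, …, f_m, g₁, …, g_k ∈ 𝔪` of length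
`dim A`. [cite: Matsumura1987, Thm. 17.4] -/
theorem exists_isRegular_append (hreg : IsRegular A rs) (hmem : ∀ r ∈ rs, r ∈ maximalIdeal A)
    (hdim : (rs.length : WithBot ℕ∞) = ringKrullDim A) (k : ℕ) :
    ∀ {fs : List A}, IsRegular A fs → (∀ f ∈ fs, f ∈ maximalIdeal A) → fs.length + k = rs.length →
      ∃ gs : List A, (∀ g ∈ gs, g ∈ maximalIdeal A) ∧ IsRegular A (fs ++ gs) ∧ gs.length = k := by
  induction k with
  | zero =>
    intro fs hf hfm _
    exact ⟨[], by simp, by simpa using hf, rfl⟩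
  | succ k ih =>
    intro fs hf hfm hlen
    obtain ⟨g, hgm, hg⟩ := exists_isRegular_append_singleton hreg hmem hdim hf hfm (by omega)
    have hfm' : ∀ f ∈ fs ++ [g], f ∈ maximalIdeal A := by
      intro f hf'
      rcases List.mem_append.mp hf' with h | h
      · exact hfm f h
      · rw [List.mem_singleton] at h
        exact h ▸ hgm
    obtain ⟨gs, hgsm, hgs, hgsl⟩ := ih hg hfm' (by simp; omega)
    refine ⟨g :: gs, fun x hx => ?_, by simpa [List.append_assoc] using hgs, by simp [hgsl]⟩
    rcases List.mem_cons.mp hx with rfl | hx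
    · exact hgm
    · exact hgsm x hx

omit [IsNoetherianRing A] in
/-- For a proper ideal `I ≤ 𝔪`, the quotient `A ⧸ I` is a (nontrivial) local ring. [folklore] -/
theorem isLocalRing_quotient_of_le_maximalIdeal {I : Ideal A} (hI : I ≤ maximalIdeal A) :
    Nontrivial (A ⧸ I) ∧ IsLocalRing (A ⧸ I) := by
  have hne : I ≠ ⊤ := fun h => (maximalIdeal.isMaximal A).ne_top (top_le_iff.mp (h ▸ hI))
  haveI : Nontrivial (A ⧸ I) := Ideal.Quotient.nontrivial_iff.mpr hne
  exact ⟨‹_›, IsLocalRing.of_surjective' (Ideal.Quotient.mk I) Ideal.Quotient.mk_surjective⟩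

omit [IsNoetherianRing A] in
/-- For `I ≤ 𝔪` and `r ∈ 𝔪`, the class of `r` lies in the maximal ideal of `A ⧸ I`. [folklore] -/
theorem mk_mem_maximalIdeal_quotient_of_le {I : Ideal A} (hI : I ≤ maximalIdeal A)
    [IsLocalRing (A ⧸ I)] {r : A} (hr : r ∈ maximalIdeal A) :
    Ideal.Quotient.mk I r ∈ maximalIdeal (A ⧸ I) := by
  rw [IsLocalRing.mem_maximalIdeal, mem_nonunits_iff]
  intro hu
  obtain ⟨s, hs⟩ := hu.exists_right_inv
  obtain ⟨s₀, rfl⟩ := Ideal.Quotient.mk_surjective s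
  rw [← map_mul, ← (Ideal.Quotient.mk I).map_one, Ideal.Quotient.eq] at hs
  apply (maximalIdeal.isMaximal A).ne_top
  rw [Ideal.eq_top_iff_one]
  have h1 : r * s₀ - (r * s₀ - 1) ∈ maximalIdeal A :=
    Ideal.sub_mem _ (Ideal.mul_mem_right _ _ hr) (hI hs)
  rwa [sub_sub_cancel] at h1

/-- **Quotients of Cohen–Macaulay local rings by regular sequences are Cohen–Macaulay** [Matsumura
Thm. 17.4; Bruns–Herzog Thm. 2.1.3], in the tree's sequence language: if the Noetherian local ring `A`
has an `A`-regular sequence in `𝔪` of length `dim A` and `f₁, …, f_m ∈ 𝔪` is `A`-regular, then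
`A ⧸ (f₁,…,f_m)` is local and has a regular sequence in its maximal ideal of length
`dim A − m = dim A ⧸ (f₁,…,f_m)`. [cite: Matsumura1987, Thm. 17.4] -/
theorem exists_isRegular_quotient_ofList (hreg : IsRegular A rs) (hmem : ∀ r ∈ rs, r ∈ maximalIdeal A)
    (hdim : (rs.length : WithBot ℕ∞) = ringKrullDim A) {fs : List A} (hf : IsRegular A fs)
    (hfm : ∀ f ∈ fs, f ∈ maximalIdeal A) :
    haveI := (isLocalRing_quotient_of_le_maximalIdeal
      ((Ideal.span_le (s := {r | r ∈ fs})).mpr fun f hf' => hfm f hf')).2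
    ∃ rs' : List (A ⧸ Ideal.ofList fs), (∀ r ∈ rs', r ∈ maximalIdeal (A ⧸ Ideal.ofList fs)) ∧
      IsRegular (A ⧸ Ideal.ofList fs) rs' ∧
      (rs'.length : WithBot ℕ∞) = ringKrullDim (A ⧸ Ideal.ofList fs) ∧
      rs'.length + fs.length = rs.length := by
  set I : Ideal A := Ideal.ofList fs with hI
  have hIm : I ≤ maximalIdeal A := (Ideal.span_le (s := {r | r ∈ fs})).mpr fun f hf' => hfm f hf'
  obtain ⟨hnt, hloc⟩ := isLocalRing_quotient_of_le_maximalIdeal hIm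
  -- lengths
  have hlen : fs.length ≤ rs.length := by
    have h := ringKrullDim_add_length_eq_ringKrullDim_of_isRegular fs hf
    rw [← hdim] at h
    exact (WithBot.eq_natCast_sub_of_add_natCast_eq h).2
  -- extend `fs` to a maximal regular sequence `fs ++ gs`
  obtain ⟨gs, hgsm, hgs, hgsl⟩ :=
    exists_isRegular_append hreg hmem hdim (rs.length - fs.length) hf hfm (by omega)
  -- `gs` is regular on the `A`-module `A/I`, hence on the ring `A/I`
  have h1 : IsWeaklyRegular (A ⧸ (I • ⊤ : Submodule A A)) gs :=
    ((isWeaklyRegular_append_iff A fs gs).mp hgs.toIsWeaklyRegular).2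
  have hI' : (I • ⊤ : Submodule A A) = I := by rw [smul_eq_mul, Ideal.mul_top]
  let e : (A ⧸ (I • ⊤ : Submodule A A)) ≃ₗ[A] (A ⧸ I) := Submodule.quotEquivOfEq _ _ hI'
  have h2 : IsWeaklyRegular (A ⧸ I) gs := (e.isWeaklyRegular_congr gs).mp h1
  have h3 : IsWeaklyRegular (A ⧸ I) (gs.map (Ideal.Quotient.mk I)) := by
    rw [← Ideal.Quotient.algebraMap_eq]
    exact (isWeaklyRegular_map_algebraMap_iff (A ⧸ I) (A ⧸ I) gs).mpr h2
  have hmem' : ∀ r ∈ gs.map (Ideal.Quotient.mk I), r ∈ maximalIdeal (A ⧸ I) := by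
    intro r hr
    obtain ⟨g, hg, rfl⟩ := List.mem_map.mp hr
    exact mk_mem_maximalIdeal_quotient_of_le hIm (hgsm g hg)
  refine ⟨gs.map (Ideal.Quotient.mk I), hmem',
    IsRegular.of_isWeaklyRegular_of_mem_maximalIdeal (A ⧸ I) hmem' h3, ?_, by simp [hgsl]; omega⟩
  -- `dim A/I = dim A − m = |gs|`
  have h := ringKrullDim_add_length_eq_ringKrullDim_of_isRegular fs hf
  rw [← hdim] at h
  rw [(WithBot.eq_natCast_sub_of_add_natCast_eq h).1, List.length_map, hgsl]

/-! ## 4. Connectedness of `A ⧸ (f₁,…,f_m)` -/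

/-- **Stub (R) for complete intersections.**  If the Noetherian local ring `A` has an `A`-regular
sequence in `𝔪` of length `dim A`, `f₁, …, f_m ∈ 𝔪` is `A`-regular and `n + 1 + m ≤ dim A`, then
`Spec A ⧸ (f₁,…,f_m)` is connected in dimension `n` (crossing form): `A ⧸ (f)` is Cohen–Macaulay of
dimension `dim A − m ≥ n + 1` (`exists_isRegular_quotient_ofList`) and Cohen–Macaulay local rings are
connected in codimension one (Hartshorne, `connectedInCodimOne_of_isCohenMacaulay`).
[cite: Hartshorne1962, Cor. 2.4] -/
theorem connected_quotient_ofList_of_isRegular (hreg : IsRegular A rs)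
    (hmem : ∀ r ∈ rs, r ∈ maximalIdeal A) (hdim : (rs.length : WithBot ℕ∞) = ringKrullDim A)
    {fs : List A} (hf : IsRegular A fs) (hfm : ∀ f ∈ fs, f ∈ maximalIdeal A)
    (n : ℕ) (hn : n + 1 + fs.length ≤ rs.length)
    (S : Set (PrimeSpectrum (A ⧸ Ideal.ofList fs)))
    (h₁ : ∃ C ∈ S, C.asIdeal ∈ minimalPrimes (A ⧸ Ideal.ofList fs))
    (h₂ : ∃ C ∉ S, C.asIdeal ∈ minimalPrimes (A ⧸ Ideal.ofList fs)) :
    ∃ C₁ ∈ S, ∃ C₂ ∉ S, C₁.asIdeal ∈ minimalPrimes (A ⧸ Ideal.ofList fs) ∧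
      C₂.asIdeal ∈ minimalPrimes (A ⧸ Ideal.ofList fs) ∧
      (n : WithBot ℕ∞) ≤ ringKrullDim ((A ⧸ Ideal.ofList fs) ⧸ (C₁.asIdeal ⊔ C₂.asIdeal)) := by
  haveI := (isLocalRing_quotient_of_le_maximalIdeal
    ((Ideal.span_le (s := {r | r ∈ fs})).mpr fun f hf' => hfm f hf')).2
  obtain ⟨rs', hmem', hreg', hdim', hlen'⟩ := exists_isRegular_quotient_ofList hreg hmem hdim hf hfm
  exact connectedInDim_of_isCohenMacaulay hreg' hmem' hdim' n (by omega) S h₁ h₂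

end CM

/-! ## 5. `μ(I) ≥ m` for an ideal generated by a regular sequence of length `m` -/

/-- If `I` is generated by an `A`-regular sequence of length `m` in the maximal ideal of a local ring of
finite dimension then `m ≤ μ(I)` (`dim A = dim A/I + m ≤ dim A/I + μ(I)` would otherwise fail:
Mathlib `ringKrullDim_add_length_eq_ringKrullDim_of_isRegular`,
`ringKrullDim_le_ringKrullDim_quotient_add_spanFinrank`).
[folklore] -/
theorem length_le_spanFinrank_of_isRegular [IsNoetherianRing A] [IsLocalRing A] {fs : List A}
    (hf : IsRegular A fs) (hfm : ∀ f ∈ fs, f ∈ maximalIdeal A) {d : ℕ} (hd : ringKrullDim A = d) :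
    fs.length ≤ (Ideal.ofList fs).spanFinrank := by
  set I : Ideal A := Ideal.ofList fs with hI
  have hIm : I ≤ maximalIdeal A := (Ideal.span_le (s := {r | r ∈ fs})).mpr fun f hf' => hfm f hf'
  have h := ringKrullDim_add_length_eq_ringKrullDim_of_isRegular fs hf
  rw [hd] at h
  obtain ⟨h1, h2⟩ := WithBot.eq_natCast_sub_of_add_natCast_eq h
  have hIjac : I ≤ Ring.jacobson A := hIm.trans (by
    rw [Ring.jacobson_eq_sInf_isMaximal]
    exact le_sInf fun J hJ => (IsLocalRing.eq_maximalIdeal hJ).ge)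
  have h3 := ringKrullDim_le_ringKrullDim_quotient_add_spanFinrank I hIjac
  rw [hd, h1] at h3
  have h4 : d ≤ (d - fs.length) + I.spanFinrank := by exact_mod_cast h3
  omega

end Summit.Langlands.Langlands.Theorems

/-! ## 6. The registered sub-goal (verbatim signature) -/

namespace Summit.Langlands.Langlands.Cruxes.ReducibleOrdinaryProModular.FineSelmerCodimensionTwo

open IsLocalRing RingTheory.Sequence

/-- **Registered sub-goal `stub_raynaudConnectedness_auxRegularSequence` = stub (R)
`stub_raynaudConnectedness` for presentations by a regular sequence**: the registered binders verbatim,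
plus the hypothesis that `I` is generated by an `A`-regular sequence in `𝔪`.  Proof: `μ(I) ≥ m`
(`length_le_spanFinrank_of_isRegular`), so `n + 1 + m ≤ dim A`; `A ⧸ I` is Cohen–Macaulay of
dimension `dim A − m` and therefore connected in dimension `n` (`connected_quotient_ofList_of_isRegular`),
transported along `R ≃+* A ⧸ I` (`crossing_of_ringEquiv`).  Completeness of `A` is not used.
[cite: Hartshorne1962, Cor. 2.4] -/
theorem stub_raynaudConnectedness_auxRegularSequence :
    ∀ (R : Type) [CommRing R] (A : Type) [CommRing A] [IsNoetherianRing A] [IsLocalRing A]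
      [IsAdicComplete (IsLocalRing.maximalIdeal A) A] (rs : List A),
      (∀ r ∈ rs, r ∈ IsLocalRing.maximalIdeal A) → RingTheory.Sequence.IsRegular A rs →
      (rs.length : WithBot ℕ∞) = ringKrullDim A →
      ∀ (I : Ideal A) (_ : R ≃+* A ⧸ I) (n : ℕ), ((n + 1 : ℕ) : WithBot ℕ∞) + I.spanFinrank ≤ ringKrullDim A →
      (∃ fs : List A, (∀ f ∈ fs, f ∈ IsLocalRing.maximalIdeal A) ∧ RingTheory.Sequence.IsRegular A fs ∧
        Ideal.ofList fs = I) →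
      ∀ S : Set (PrimeSpectrum R),
        (∃ C ∈ S, C.asIdeal ∈ minimalPrimes R) → (∃ C ∉ S, C.asIdeal ∈ minimalPrimes R) →
          ∃ C₁ ∈ S, ∃ C₂ ∉ S, C₁.asIdeal ∈ minimalPrimes R ∧ C₂.asIdeal ∈ minimalPrimes R ∧
            (n : WithBot ℕ∞) ≤ ringKrullDim (R ⧸ (C₁.asIdeal ⊔ C₂.asIdeal)) := by
  intro R _ A _ _ _ _ rs hmem hreg hdim I e n hle hfs S h₁ h₂
  obtain ⟨fs, hfm, hf, rfl⟩ := hfs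
  -- `n + 1 + m ≤ dim A`
  have hμ := Summit.Langlands.Langlands.Theorems.length_le_spanFinrank_of_isRegular hf hfm hdim.symm
  have hn : n + 1 + fs.length ≤ rs.length := by
    have h1 : ((n + 1 : ℕ) : WithBot ℕ∞) + (Ideal.ofList fs).spanFinrank ≤ rs.length := hle.trans_eq hdim.symm
    have h2 : n + 1 + (Ideal.ofList fs).spanFinrank ≤ rs.length := by exact_mod_cast h1
    omega
  exact Summit.Langlands.Langlands.Theorems.crossing_of_ringEquiv e n
    (fun S' h₁' h₂' => Summit.Langlands.Langlands.Theorems.connected_quotient_ofList_of_isRegular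
      hreg hmem hdim hf hfm n hn S' h₁' h₂') S h₁ h₂

end Summit.Langlands.Langlands.Cruxes.ReducibleOrdinaryProModular.FineSelmerCodimensionTwo
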